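import Summits.AtomisticToContinuum.HydrodynamicLimit.Theses.OneFlightGossipEngine
import Summits.AtomisticToContinuum.HydrodynamicLimit.Theses.ImplosionDichotomy
import Summits.AtomisticToContinuum.HydrodynamicLimit.Theorems.ImplosionDichotomyHydroLimitInBandOfHeart
import Summits.AtomisticToContinuum.HydrodynamicLimit.Theorems.ImplosionDichotomyHydroLimitInBandWindowContinuity
import HarnessLib

/-!
# Route OneFlightGossipEngine — `Assembly` (stmt-AtomisticToContinuum-17616) and `ClampedTransferDock`
# (stmt-AtomisticToContinuum-17615) from the shared one-window HEART and the dock's three requested split children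

Support file (rev 29; first landed for rev 25 as p126675 `--supports stmt-AtomisticToContinuum-16666`, re-proved with the
same statements after the rev-29 restate made the dock and the frame DSC-free and the statement re-type D-0032 re-typed
`ImplosionDichotomy.closes`). Kernel-checked, sorry-free bookkeeping in the TREE:

* `clampedTransferDock_of_heart` — the rev-29 dock `ClampedTransferDock = KCWF → CAT → ECT → HydrodynamicLimit` follows from
  the shared heart `HydroLimitInBandOfHeart.OneWindowLedger` (registered stub `stub_oneWindowLedger` of the dock line /
  `stub_oneWindowLedgerInBand` of the in-band line; its two clauses are landed, `HydroLimitInBandHeart.stub_windowClause`,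
  `HydroLimitInBandHeart.stub_staticClause`, and the named theorem `oneWindowLedger_holds` is proposed by the in-band lead)
  and EXACTLY the three conjecture-grade inputs the planner filed as the SPLIT-REQUEST children of the dock, typed by their
  LANDED in-band copies `HydroLimitInBandOfHeart.{LocalClampedTransferWindowLDFamily, CollisionEnergyActivityTails,
  CoherentSuprathermalContentVanishesW}`: the landed `hydroLimitInBand_of_heart` gives `ImplosionDichotomy.HydroLimitInBand`
  from the heart, the landed window continuity `HydroLimitInBandContinuity.stub_windowContinuityInBand` and the six inputs
  (KCWF = `KineticCurrentsWindowLDFamily` definitionally, CAT, ECT by name), and `HydroLimitInBand` IS the re-typed conjunct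
  (`hydroLimitInBand_iff_hydrodynamicLimit`, `Iff.rfl`) — no `ImplosionDichotomy.closes`, no DSC;
* `assembly_of_heart` — the frame `Assembly = OneFlightLayeredChaos → ClampedTransferDock` (definitionally,
  `Theorems.oneFlightGossipEngine_assembly_iff_clampedTransferDock`) with the mechanism crux idle;
* `kineticCurrentsLDAlongFamilies_iff_family` — KCWF (stmt-16659) IS the heart's `KineticCurrentsWindowLDFamily` (`Iff.rfl`), the
  typing the UNIFORMITY finding asked for;
* `diluteSelfConsistency_iff_implosionDichotomy` — record of the rev-25 bridge (DSC is one term in both routes), kept append-only.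

Nothing here claims mathematical content beyond composition; the three children and the heart are where the mathematics is.
-/

namespace Summit.AtomisticToContinuum.HydrodynamicLimit.Theorems

open Summit.AtomisticToContinuum.HydrodynamicLimit.Theses
open Summit.AtomisticToContinuum.HydrodynamicLimit.Theorems.HydroLimitInBandOfHeart
  (OneWindowLedger LineInputs LocalClampedTransferWindowLDFamily CollisionEnergyActivityTails
    CoherentSuprathermalContentVanishesW KineticCurrentsWindowLDFamily hydroLimitInBand_of_heart)
open Summit.AtomisticToContinuum.HydrodynamicLimit.Theorems.HydroLimitInBandContinuity (stub_windowContinuityInBand)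

/-- **KCWF is the heart's kinetic input, definitionally.** The route's docking node `KineticCurrentsLDAlongFamilies`
(stmt-AtomisticToContinuum-16659) and the in-band heart's `KineticCurrentsWindowLDFamily` are the same term. [folklore] -/
theorem kineticCurrentsLDAlongFamilies_iff_family :
    OneFlightGossipEngine.KineticCurrentsLDAlongFamilies ↔ KineticCurrentsWindowLDFamily :=
  Iff.rfl

/-- **The shared support DSC is one term in both routes** (stmt-AtomisticToContinuum-3091 re-asked verbatim by
ImplosionDichotomy; since rev 29 no longer an antecedent of this route's dock or frame — kept as the record of the
rev-25 proof's bridge). [folklore] -/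
theorem diluteSelfConsistency_iff_implosionDichotomy :
    OneFlightGossipEngine.DiluteSelfConsistency ↔ ImplosionDichotomy.DiluteSelfConsistency :=
  Iff.rfl

/-- **The in-band crux IS the re-typed conjunct** (statement re-type D-0032, 2026-08-16): ImplosionDichotomy's
`HydroLimitInBand` (stmt-AtomisticToContinuum-9133) and the packing-guarded summit conjunct
`_root_.HydrodynamicLimit` are the same term (`Iff.rfl`), so the heart corollary concludes the conjunct with no
`ImplosionDichotomy.closes` and no `DiluteSelfConsistency` (dock disprover's finding F1-DSC-IDLE). [folklore] -/
theorem hydroLimitInBand_iff_hydrodynamicLimit :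
    ImplosionDichotomy.HydroLimitInBand ↔ _root_.HydrodynamicLimit :=
  Iff.rfl

/-- **The dock from the heart and its three requested split children.** `ClampedTransferDock` (rev 29,
stmt-AtomisticToContinuum-17615: `KineticCurrentsLDAlongFamilies → CollisionActivityTails → EnergyCurrentTails →
HydrodynamicLimit`, DSC-free) follows from the shared one-window heart `OneWindowLedger` and the three conjecture-grade inputs
(iii) `LocalClampedTransferWindowLDFamily`, (iv) `CollisionEnergyActivityTails`, (ii) `CoherentSuprathermalContentVanishesW`:
bundle them with the dock's own binders KCWF, CAT, ECT into `LineInputs`, run the landed `hydroLimitInBand_of_heart` with the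
landed window continuity, and transport along `hydroLimitInBand_iff_hydrodynamicLimit` (`Iff.rfl`). (Rev-25 proof, p126675,
went through `ImplosionDichotomy.closes` and the binder DSC; both left the statement with the re-type.) [cite: Yau1991, §2] -/
theorem clampedTransferDock_of_heart (hW : OneWindowLedger) (hL : LocalClampedTransferWindowLDFamily)
    (hE : CollisionEnergyActivityTails) (hC : CoherentSuprathermalContentVanishesW) :
    OneFlightGossipEngine.ClampedTransferDock :=
  fun hK h₇ h₆ =>
    hydroLimitInBand_iff_hydrodynamicLimit.mp
      (hydroLimitInBand_of_heart hW stub_windowContinuityInBand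
        ⟨hL, hE, hC, kineticCurrentsLDAlongFamilies_iff_family.mp hK, h₇, h₆⟩)

/-- **The frame from the heart and the three children** (item stmt-AtomisticToContinuum-17616, rev 29; formerly
stmt-16666): `Assembly` is `OneFlightLayeredChaos → ClampedTransferDock` definitionally, the mechanism crux being idle.
[cite: Yau1991, §2] -/
theorem assembly_of_heart (hW : OneWindowLedger) (hL : LocalClampedTransferWindowLDFamily)
    (hE : CollisionEnergyActivityTails) (hC : CoherentSuprathermalContentVanishesW) :
    OneFlightGossipEngine.Assembly :=
  fun _ => clampedTransferDock_of_heart hW hL hE hC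

end Summit.AtomisticToContinuum.HydrodynamicLimit.Theorems
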